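import Literature.Probability.Percolation.SelfRefinementMeasure
import Literature.Probability.Percolation.KohlerSchindlerTassionRSW
import Summits.CriticalPhenomena.CardyFormulaZ2.Theorems.CardySelfRefinementCriticalPathRSWStubCone3Pivot

/-!
# Stub `stub_cone3` of line `finite-size-envelope` (crux `CriticalPathRSW`), part 10:
the chain events (tuple open, some interior labels closed) as pivotality probabilities

Support file for item `stmt-CriticalPhenomena-10267` (stub `stub_cone3`).  Probability layer of the
local surgeries.  With the coin law `P = prodBernoulli (refinementParam 3 ρ c)` (`0 ≤ ρ ≤ 1`,
`0 ≤ c ≤ 1`), the tuple `(b, d)` with its frame `pt⟪α, β⟫`, sub-edges `T`, and the override events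
`Z⟪C, A⟫` ("close `C`, open `A`, the box `[-3n, 3n] × [-9n, 9n]` is crossed"):

* `Cone3.chain_event_subset` — the conclusion of the chain case, "with `S₁ ∪ {f}` closed and the
  tuple open the sides are joined iff `f` is reopened", lies in
  `Z⟪{f} ∪ S₁, {f} ∪ T⟫ \ Z⟪{f} ∪ S₁, ∅ ∪ T⟫`;
* **`Cone3.chain_event_bound`** — `(1/8) (1-c)^{|S₁|} · P(Z⟪{f} ∪ S₁, {f} ∪ T⟫ \ Z⟪{f} ∪ S₁, ∅ ∪ T⟫)
  ≤ P(f pivotal)`, uniformly in `ρ`: the tuple is put in its all-OPEN state through both of its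
  representations (selector on & shared coin on, or selector off & own coins on, total probability
  `ρ/2 + (1-ρ)/8 ≥ 1/8`) and the labels of `S₁` are closed at cost `1 - c` each.

References: Aizenman–Grimmett 1991 §3; Grimmett 1999 §2.4 (pivotality), §2.2 (cylinders).
-/

noncomputable section

namespace Summit.CriticalPhenomena.CardyFormulaZ2.Cruxes.CriticalPathRSW.FiniteSizeEnvelope

open Set MeasureTheory
open Literature.Probability.LatticeModels Literature.Probability.Percolation

namespace Cone3

variable {n : ℕ} {ρ c : ℝ} {b : Site 2} {d d' : Fin 2}

set_option quotPrecheck false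

/-- The local frame of the tuple `(b, d)`: `pt⟪α, β⟫ = 3b + α e_d + β e_{d'}`. -/
local notation "pt⟪" α ", " β "⟫" =>
  ((3 : ℤ) • b + (α : ℤ) • (Pi.single d (1 : ℤ) : Site 2) + (β : ℤ) • (Pi.single d' (1 : ℤ) : Site 2))

/-- The open labels of a coin configuration. -/
local notation "Op⟪" S "⟫" => {e : Site 2 × Fin 2 | RefinementOpen 3 S e}

/-- The override event: close `C`, open `A`, and ask for a left-right crossing of the box. -/
local notation "Z⟪" C ", " A "⟫" =>
  {S : Set (Site 2 × Fin 2 × Fin 3) |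
    edgeConfig ((Op⟪S⟫ \ C) ∪ A) ∈ KST2023.crossing (3 * n) (3 * (3 * n))}

/-- The three sub-edges of the tuple. -/
local notation "Tl" =>
  ({(pt⟪0, 0⟫, d), (pt⟪1, 0⟫, d), (pt⟪2, 0⟫, d)} : Set (Site 2 × Fin 2))

/-- The coin law. -/
local notation "P" => (prodBernoulli (refinementParam 3 ρ c))

/-! ### The chain events -/

/-- **The chain conclusion as an override event.** -/
theorem chain_event_subset (S₁ : Set (Site 2 × Fin 2)) (f : Site 2 × Fin 2) :
    {S : Set (Site 2 × Fin 2 × Fin 3) |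
        edgeConfig ((Op⟪S⟫ \ (Tl ∪ S₁ ∪ {f})) ∪ (Tl ∪ {f})) ∈ KST2023.crossing (3 * n) (3 * (3 * n)) ∧
          edgeConfig ((Op⟪S⟫ \ (Tl ∪ S₁ ∪ {f})) ∪ Tl) ∉ KST2023.crossing (3 * n) (3 * (3 * n))} ⊆
      Z⟪{f} ∪ S₁, {f} ∪ Tl⟫ \ Z⟪{f} ∪ S₁, ∅ ∪ Tl⟫ := by
  rintro S ⟨hyes, hno⟩
  constructor
  · refine crossing_mono (fun e he => ?_) hyes
    rcases he with ⟨heO, heC⟩ | heT | hef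
    · exact Or.inl ⟨heO, fun h => heC (h.elim (fun h' => Or.inr h') (fun h' => Or.inl (Or.inr h')))⟩
    · exact Or.inr (Or.inr heT)
    · exact Or.inr (Or.inl hef)
  · intro h
    apply hno
    refine crossing_mono (fun e he => ?_) h
    rcases he with ⟨heO, heC⟩ | heA
    · by_cases heT : e ∈ Tl
      · exact Or.inr heT
      · exact Or.inl ⟨heO, fun h' => h'.elim (fun h'' => h''.elim heT (fun h3 => heC (Or.inr h3)))
          (fun h'' => heC (Or.inl h''))⟩
    · rcases heA with heA | heA
      · exact absurd heA (Set.notMem_empty e)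
      · exact Or.inr heA

/-- **The chain event bound, uniform in `ρ`.** For interior labels `S₁` (finite) and an interior
label `f ∉ S₁`: `(1/8) (1-c)^{|S₁|} · P(Z⟪{f} ∪ S₁, {f} ∪ T⟫ \ Z⟪{f} ∪ S₁, ∅ ∪ T⟫) ≤ P(f pivotal)`. -/
theorem chain_event_bound (hd : d' ≠ d) (hρ0 : 0 ≤ ρ) (hρ1 : ρ ≤ 1) (hc0 : 0 ≤ c) (hc1 : c ≤ 1)
    {S₁ : Finset (Site 2 × Fin 2)} (hS₁ : ∀ ℓ ∈ S₁, ¬ IsAxialEdge 3 ℓ) {f : Site 2 × Fin 2}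
    (hf : ¬ IsAxialEdge 3 f) :
    (1 / 8 : ℝ) * (1 - c) ^ S₁.card *
        (P).real (Z⟪{f} ∪ ↑S₁, {f} ∪ Tl⟫ \ Z⟪{f} ∪ ↑S₁, ∅ ∪ Tl⟫) ≤
      (P).real (Z⟪({f} : Set (Site 2 × Fin 2)), ({f} : Set (Site 2 × Fin 2))⟫ \
        Z⟪({f} : Set (Site 2 × Fin 2)), (∅ : Set (Site 2 × Fin 2))⟫) := by
  classical
  -- names
  set E := Z⟪{f} ∪ ↑S₁, {f} ∪ Tl⟫ \ Z⟪{f} ∪ ↑S₁, ∅ ∪ Tl⟫ with hE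
  set Piv := Z⟪({f} : Set (Site 2 × Fin 2)), ({f} : Set (Site 2 × Fin 2))⟫ \
    Z⟪({f} : Set (Site 2 × Fin 2)), (∅ : Set (Site 2 × Fin 2))⟫ with hPiv
  set σ : Site 2 × Fin 2 × Fin 3 := (b, d, (2 : Fin 3)) with hσ
  set h : Site 2 × Fin 2 × Fin 3 := (b, d, (1 : Fin 3)) with hh
  set o₀ : Site 2 × Fin 2 × Fin 3 := (pt⟪0, 0⟫, d, (0 : Fin 3)) with ho₀
  set o₁ : Site 2 × Fin 2 × Fin 3 := (pt⟪1, 0⟫, d, (0 : Fin 3)) with ho₁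
  set o₂ : Site 2 × Fin 2 × Fin 3 := (pt⟪2, 0⟫, d, (0 : Fin 3)) with ho₂
  set Sc : Finset (Site 2 × Fin 2 × Fin 3) := S₁.image (fun ℓ => (ℓ.1, ℓ.2, (0 : Fin 3))) with hSc
  set F₁ : Finset (Site 2 × Fin 2 × Fin 3) := insert σ (insert h Sc) with hF₁
  set F₂ : Finset (Site 2 × Fin 2 × Fin 3) := insert σ (insert o₀ (insert o₁ (insert o₂ Sc))) with hF₂
  set Y₁ := localCylinder (↑F₁ : Set (Site 2 × Fin 2 × Fin 3)) ({σ, h} : Set (Site 2 × Fin 2 × Fin 3)) with hY₁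
  set Y₂ := localCylinder (↑F₂ : Set (Site 2 × Fin 2 × Fin 3)) ({o₀, o₁, o₂} : Set (Site 2 × Fin 2 × Fin 3))
    with hY₂
  -- distinctness of coins
  have hσh : σ ≠ h := by simp [hσ, hh]
  have hσSc : σ ∉ Sc := by
    simp only [hSc, Finset.mem_image, not_exists, not_and, hσ]
    intro ℓ _ h'; simp [Prod.mk.injEq] at h'
  have hhSc : h ∉ Sc := by
    simp only [hSc, Finset.mem_image, not_exists, not_and, hh]
    intro ℓ _ h'; simp [Prod.mk.injEq] at h'
  have hoSc : ∀ j : ℤ, (pt⟪j, 0⟫, d, (0 : Fin 3)) ∉ Sc := by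
    intro j hj
    simp only [hSc, Finset.mem_image] at hj
    obtain ⟨ℓ, hℓ, hℓj⟩ := hj
    exact own_ne_sub hd (hS₁ ℓ hℓ) j hℓj.symm
  have hσo : ∀ j : ℤ, σ ≠ (pt⟪j, 0⟫, d, (0 : Fin 3)) := by intro j; simp [hσ]
  have hho : ∀ j : ℤ, h ≠ (pt⟪j, 0⟫, d, (0 : Fin 3)) := by intro j; simp [hh]
  have ho01 : o₀ ≠ o₁ := by
    simp only [ho₀, ho₁, Ne, Prod.mk.injEq, pt_eq_iff hd]; norm_num
  have ho02 : o₀ ≠ o₂ := by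
    simp only [ho₀, ho₂, Ne, Prod.mk.injEq, pt_eq_iff hd]; norm_num
  have ho12 : o₁ ≠ o₂ := by
    simp only [ho₁, ho₂, Ne, Prod.mk.injEq, pt_eq_iff hd]; norm_num
  have hσF₁ : σ ∉ insert h Sc := by simp [hσh, hσSc]
  have ho₂F : o₂ ∉ Sc := hoSc 2
  have ho₁F : o₁ ∉ insert o₂ Sc := by
    rw [Finset.mem_insert, not_or]; exact ⟨ho12, hoSc 1⟩
  have ho₀F : o₀ ∉ insert o₁ (insert o₂ Sc) := by
    simp only [Finset.mem_insert, not_or]; exact ⟨ho01, ho02, hoSc 0⟩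
  have hσF₂ : σ ∉ insert o₀ (insert o₁ (insert o₂ Sc)) := by
    simp only [Finset.mem_insert, not_or]; exact ⟨hσo 0, hσo 1, hσo 2, hσSc⟩
  -- states forced on the cylinders
  have hY₁σ : ∀ S ∈ Y₁, σ ∈ S := fun S hS => (hS σ (by simp [hF₁])).2 (by simp)
  have hY₁h : ∀ S ∈ Y₁, h ∈ S := fun S hS => (hS h (by simp [hF₁])).2 (by simp)
  have hY₂σ : ∀ S ∈ Y₂, σ ∉ S := fun S hS hS' => by
    have := (hS σ (by simp [hF₂])).1 hS'
    simp only [Set.mem_insert_iff, Set.mem_singleton_iff] at this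
    exact this.elim (hσo 0) (fun h' => h'.elim (hσo 1) (hσo 2))
  have hY₂o : ∀ S ∈ Y₂, ∀ j : ℤ, (j = 0 ∨ j = 1 ∨ j = 2) → (pt⟪j, 0⟫, d, (0 : Fin 3)) ∈ S := by
    intro S hS j hj
    rcases hj with rfl | rfl | rfl
    · exact (hS o₀ (by simp [hF₂])).2 (by simp)
    · exact (hS o₁ (by simp [hF₂])).2 (by simp)
    · exact (hS o₂ (by simp [hF₂])).2 (by simp)
  have hYS : ∀ S, (S ∈ Y₁ ∨ S ∈ Y₂) → ∀ ℓ ∈ (↑S₁ : Set (Site 2 × Fin 2)), ¬ RefinementOpen 3 S ℓ := by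
    intro S hS ℓ hℓ
    rw [Finset.mem_coe] at hℓ
    rw [refinementOpen_iff_of_not_axial (hS₁ ℓ hℓ)]
    have hc : (ℓ.1, ℓ.2, (0 : Fin 3)) ∈ Sc := Finset.mem_image_of_mem _ hℓ
    rcases hS with hS | hS
    · intro h'
      have := (hS _ (by simp [hF₁, hc])).1 h'
      simp only [Set.mem_insert_iff, Set.mem_singleton_iff] at this
      rcases this with h'' | h''
      · exact hσSc (h'' ▸ hc)
      · exact hhSc (h'' ▸ hc)
    · intro h'
      have := (hS _ (by simp [hF₂, hc])).1 h'
      simp only [Set.mem_insert_iff, Set.mem_singleton_iff] at this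
      rcases this with h'' | h'' | h''
      · exact hoSc 0 (by rw [ho₀] at h''; rw [← h'']; exact hc)
      · exact hoSc 1 (by rw [ho₁] at h''; rw [← h'']; exact hc)
      · exact hoSc 2 (by rw [ho₂] at h''; rw [← h'']; exact hc)
  have hYT : ∀ S, (S ∈ Y₁ ∨ S ∈ Y₂) → ∀ e ∈ Tl, RefinementOpen 3 S e := by
    intro S hS e he
    have key : ∀ j : ℤ, 0 ≤ j → j < 3 → RefinementOpen 3 S (pt⟪j, 0⟫, d) := by
      intro j h0 h3
      rw [refinementOpen_sub_iff hd S h0 h3]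
      rcases hS with hS | hS
      · exact Or.inl ⟨hY₁σ S hS, hY₁h S hS⟩
      · exact Or.inr ⟨hY₂σ S hS, hY₂o S hS j (by omega)⟩
    simp only [Set.mem_insert_iff, Set.mem_singleton_iff] at he
    rcases he with rfl | rfl | rfl
    · exact key 0 le_rfl (by norm_num)
    · exact key 1 (by norm_num) (by norm_num)
    · exact key 2 (by norm_num) (by norm_num)
  -- on the cylinders the pivotality event is `E`
  have hTC : ∀ e ∈ Tl, e ∉ ({f} ∪ ↑S₁ : Set (Site 2 × Fin 2)) := by
    intro e he he'
    rcases he' with he' | he'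
    · rw [Set.mem_singleton_iff] at he'
      exact not_mem_Tl_of_interior hd hf (he' ▸ he)
    · exact not_mem_Tl_of_interior hd (hS₁ e (Finset.mem_coe.1 he')) he
  have hPivY : ∀ Y : Set (Set (Site 2 × Fin 2 × Fin 3)), (Y = Y₁ ∨ Y = Y₂) → Piv ∩ Y = E ∩ Y := by
    intro Y hY
    have hS' : ∀ S ∈ Y, ∀ e ∈ (↑S₁ : Set (Site 2 × Fin 2)), ¬ RefinementOpen 3 S e := fun S hS =>
      hYS S (hY.elim (fun h' => Or.inl (h' ▸ hS)) (fun h' => Or.inr (h' ▸ hS)))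
    have hT' : ∀ S ∈ Y, ∀ e ∈ Tl, RefinementOpen 3 S e := fun S hS =>
      hYT S (hY.elim (fun h' => Or.inl (h' ▸ hS)) (fun h' => Or.inr (h' ▸ hS)))
    have h1 : Z⟪({f} : Set (Site 2 × Fin 2)), ({f} : Set (Site 2 × Fin 2))⟫ ∩ Y =
        Z⟪{f} ∪ ↑S₁, {f} ∪ Tl⟫ ∩ Y := by
      rw [Z_inter_eq_of_closed hS', Z_inter_eq_of_open hT' hTC]
    have h2 : Z⟪({f} : Set (Site 2 × Fin 2)), (∅ : Set (Site 2 × Fin 2))⟫ ∩ Y =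
        Z⟪{f} ∪ ↑S₁, ∅ ∪ Tl⟫ ∩ Y := by
      rw [Z_inter_eq_of_closed hS', Z_inter_eq_of_open hT' hTC]
    rw [hPiv, hE]
    ext S
    constructor
    · rintro ⟨⟨hS1, hS2⟩, hSY⟩
      exact ⟨⟨((Set.ext_iff.1 h1 S).1 ⟨hS1, hSY⟩).1,
        fun hS2' => hS2 ((Set.ext_iff.1 h2 S).2 ⟨hS2', hSY⟩).1⟩, hSY⟩
    · rintro ⟨⟨hS1, hS2⟩, hSY⟩
      exact ⟨⟨((Set.ext_iff.1 h1 S).2 ⟨hS1, hSY⟩).1,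
        fun hS2' => hS2 ((Set.ext_iff.1 h2 S).1 ⟨hS2', hSY⟩).1⟩, hSY⟩
  -- measurability and locality of `E`
  have hEm : MeasurableSet E := (measurableSet_Z _ _).diff (measurableSet_Z _ _)
  have hPivm : MeasurableSet Piv := (measurableSet_Z _ _).diff (measurableSet_Z _ _)
  have hsubT : ∀ F : Finset (Site 2 × Fin 2 × Fin 3), (∀ i ∈ F, i = σ ∨ i = h ∨ i = o₀ ∨ i = o₁ ∨ i = o₂ ∨ i ∈ Sc) →
      (↑F : Set (Site 2 × Fin 2 × Fin 3)) ⊆ {(b, d, (2 : Fin 3)), (b, d, (1 : Fin 3)), (pt⟪0, 0⟫, d, (0 : Fin 3)),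
        (pt⟪1, 0⟫, d, (0 : Fin 3)), (pt⟪2, 0⟫, d, (0 : Fin 3))} ∪
        (fun ℓ : Site 2 × Fin 2 => (ℓ.1, ℓ.2, (0 : Fin 3))) '' (↑S₁ ∪ {f}) := by
    intro F hF i hi
    rcases hF i (Finset.mem_coe.1 hi) with rfl | rfl | rfl | rfl | rfl | hi'
    · exact Or.inl (by simp [hσ])
    · exact Or.inl (by simp [hh])
    · exact Or.inl (by simp [ho₀])
    · exact Or.inl (by simp [ho₁])
    · exact Or.inl (by simp [ho₂])
    · simp only [hSc, Finset.mem_image] at hi'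
      obtain ⟨ℓ, hℓ, rfl⟩ := hi'
      exact Or.inr ⟨ℓ, Or.inl (Finset.mem_coe.2 hℓ), rfl⟩
  have hCA : ∀ A : Set (Site 2 × Fin 2), Tl ⊆ A → ∀ e : Site 2 × Fin 2,
      (e = (pt⟪0, 0⟫, d) ∨ e = (pt⟪1, 0⟫, d) ∨ e = (pt⟪2, 0⟫, d) ∨ e ∈ (↑S₁ ∪ {f} : Set (Site 2 × Fin 2))) →
      e ∈ ({f} ∪ ↑S₁ : Set (Site 2 × Fin 2)) ∪ A := by
    intro A hA e he
    rcases he with rfl | rfl | rfl | he | he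
    · exact Or.inr (hA (by simp))
    · exact Or.inr (hA (by simp))
    · exact Or.inr (hA (by simp))
    · exact Or.inl (Or.inr he)
    · exact Or.inl (Or.inl he)
  have hdet : ∀ F : Finset (Site 2 × Fin 2 × Fin 3), (∀ i ∈ F, i = σ ∨ i = h ∨ i = o₀ ∨ i = o₁ ∨ i = o₂ ∨ i ∈ Sc) →
      DeterminedBy E (↑F : Set (Site 2 × Fin 2 × Fin 3))ᶜ := by
    intro F hF
    exact determinedBy_sdiff (determinedBy_Z hd (hsubT F hF) (hCA _ Set.subset_union_right))
      (determinedBy_Z hd (hsubT F hF) (hCA _ Set.subset_union_right))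
  have hF₁mem : ∀ i ∈ F₁, i = σ ∨ i = h ∨ i = o₀ ∨ i = o₁ ∨ i = o₂ ∨ i ∈ Sc := by
    intro i hi
    simp only [hF₁, Finset.mem_insert] at hi
    rcases hi with hi | hi | hi
    · exact Or.inl hi
    · exact Or.inr (Or.inl hi)
    · exact Or.inr (Or.inr (Or.inr (Or.inr (Or.inr hi))))
  have hF₂mem : ∀ i ∈ F₂, i = σ ∨ i = h ∨ i = o₀ ∨ i = o₁ ∨ i = o₂ ∨ i ∈ Sc := by
    intro i hi
    simp only [hF₂, Finset.mem_insert] at hi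
    rcases hi with hi | hi | hi | hi | hi
    · exact Or.inl hi
    · exact Or.inr (Or.inr (Or.inl hi))
    · exact Or.inr (Or.inr (Or.inr (Or.inl hi)))
    · exact Or.inr (Or.inr (Or.inr (Or.inr (Or.inl hi))))
    · exact Or.inr (Or.inr (Or.inr (Or.inr (Or.inr hi))))
  -- probabilities of the cylinders
  have hScard : Sc.card ≤ S₁.card := Finset.card_image_le
  have h1c0 : (0 : ℝ) ≤ 1 - c := by linarith
  have h1c1 : 1 - c ≤ (1 : ℝ) := by linarith
  have hprodSc : ∀ pat : Set (Site 2 × Fin 2 × Fin 3), (∀ i ∈ Sc, i ∉ pat) →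
      (1 - c) ^ S₁.card ≤ ∏ i ∈ Sc, (if i ∈ pat then ((refinementParam 3 ρ c i : unitInterval) : ℝ)
        else 1 - ((refinementParam 3 ρ c i : unitInterval) : ℝ)) := by
    intro pat hpat
    have : ∏ i ∈ Sc, (if i ∈ pat then ((refinementParam 3 ρ c i : unitInterval) : ℝ)
        else 1 - ((refinementParam 3 ρ c i : unitInterval) : ℝ)) = ∏ i ∈ Sc, (1 - c) := by
      refine Finset.prod_congr rfl fun i hi => ?_
      rw [if_neg (hpat i hi)]
      simp only [hSc, Finset.mem_image] at hi
      obtain ⟨ℓ, hℓ, rfl⟩ := hi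
      rw [coe_param_interior hc0 hc1 (hS₁ ℓ hℓ)]
    rw [this, Finset.prod_const]
    exact pow_le_pow_of_le_one h1c0 h1c1 hScard
  have hSc₁ : ∀ i ∈ Sc, i ∉ ({σ, h} : Set (Site 2 × Fin 2 × Fin 3)) := by
    intro i hi hi'
    simp only [Set.mem_insert_iff, Set.mem_singleton_iff] at hi'
    rcases hi' with rfl | rfl
    · exact hσSc hi
    · exact hhSc hi
  have hSc₂ : ∀ i ∈ Sc, i ∉ ({o₀, o₁, o₂} : Set (Site 2 × Fin 2 × Fin 3)) := by
    intro i hi hi'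
    simp only [Set.mem_insert_iff, Set.mem_singleton_iff] at hi'
    rcases hi' with rfl | rfl | rfl
    · exact hoSc 0 hi
    · exact hoSc 1 hi
    · exact hoSc 2 hi
  have hY₁prob : ρ * (1 / 2) * (1 - c) ^ S₁.card ≤ (P).real Y₁ := by
    rw [hY₁, real_localCylinder_eq, hF₁, Finset.prod_insert hσF₁, Finset.prod_insert hhSc,
      if_pos (by simp), if_pos (by simp), coe_param_selector hρ0 hρ1, coe_param_shared]
    have := hprodSc {σ, h} hSc₁
    have h12 : (0 : ℝ) ≤ ρ * (1 / 2) := by positivity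
    refine le_trans (mul_le_mul_of_nonneg_left this h12) (le_of_eq ?_)
    ring
  have hY₂prob : (1 - ρ) * (1 / 8) * (1 - c) ^ S₁.card ≤ (P).real Y₂ := by
    rw [hY₂, real_localCylinder_eq, hF₂, Finset.prod_insert hσF₂, Finset.prod_insert ho₀F,
      Finset.prod_insert ho₁F, Finset.prod_insert ho₂F,
      if_neg (by simp only [Set.mem_insert_iff, Set.mem_singleton_iff, not_or]; exact ⟨hσo 0, hσo 1, hσo 2⟩),
      if_pos (by simp), if_pos (by simp), if_pos (by simp), coe_param_selector hρ0 hρ1, ho₀, ho₁, ho₂,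
      coe_param_sub hd, coe_param_sub hd, coe_param_sub hd]
    have := hprodSc {o₀, o₁, o₂} hSc₂
    rw [ho₀, ho₁, ho₂] at this
    have h12 : (0 : ℝ) ≤ (1 - ρ) * (1 / 8) := by nlinarith
    refine le_trans (mul_le_mul_of_nonneg_left this h12) (le_of_eq ?_)
    ring
  -- the two cylinders are disjoint and factor out
  have hdisj : Disjoint (Piv ∩ Y₁) (Piv ∩ Y₂) :=
    Set.disjoint_left.2 fun S h1 h2 => hY₂σ S h2.2 (hY₁σ S h1.2)
  have hY₂m : MeasurableSet Y₂ := measurableSet_localCylinder F₂.finite_toSet.countable _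
  have hfac₁ : (P).real (Piv ∩ Y₁) = (P).real Y₁ * (P).real E := by
    rw [hPivY Y₁ (Or.inl rfl), Set.inter_comm]; exact real_localCylinder_inter _ F₁ _ (hdet F₁ hF₁mem) hEm
  have hfac₂ : (P).real (Piv ∩ Y₂) = (P).real Y₂ * (P).real E := by
    rw [hPivY Y₂ (Or.inr rfl), Set.inter_comm]; exact real_localCylinder_inter _ F₂ _ (hdet F₂ hF₂mem) hEm
  have hsum : (P).real (Piv ∩ Y₁) + (P).real (Piv ∩ Y₂) ≤ (P).real Piv := by
    rw [← measureReal_union hdisj (hPivm.inter hY₂m)]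
    exact measureReal_mono (Set.union_subset Set.inter_subset_left Set.inter_subset_left)
  have hE0 : 0 ≤ (P).real E := measureReal_nonneg
  have hcS : 0 ≤ (1 - c) ^ S₁.card := pow_nonneg h1c0 _
  calc (1 / 8 : ℝ) * (1 - c) ^ S₁.card * (P).real E
      ≤ (ρ * (1 / 2) * (1 - c) ^ S₁.card + (1 - ρ) * (1 / 8) * (1 - c) ^ S₁.card) * (P).real E := by
        apply mul_le_mul_of_nonneg_right _ hE0
        nlinarith
    _ ≤ ((P).real Y₁ + (P).real Y₂) * (P).real E := by
        apply mul_le_mul_of_nonneg_right _ hE0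
        linarith
    _ = (P).real (Piv ∩ Y₁) + (P).real (Piv ∩ Y₂) := by rw [hfac₁, hfac₂]; ring
    _ ≤ (P).real Piv := hsum

end Cone3

/-- **Registered sub-goal `stub_cone3_pivotB` of stub `stub_cone3`** (`Cone3.chain_event_bound` with all local notations
expanded). -/
theorem stub_cone3_pivotB : ∀ {n : ℕ} {ρ c : ℝ} {b : Site 2} {d d' : Fin 2} (hd : d' ≠ d) (hρ0 : 0 ≤ ρ) (hρ1 : ρ ≤ 1) (hc0 : 0 ≤ c) (hc1 : c ≤ 1) {S₁ : Finset (Site 2 × Fin 2)} (hS₁ : ∀ ℓ ∈ S₁, ¬ IsAxialEdge 3 ℓ) {f : Site 2 × Fin 2} (hf : ¬ IsAxialEdge 3 f), (1 / 8 : ℝ) * (1 - c) ^ S₁.card * (((prodBernoulli (refinementParam 3 ρ c)))).real (({S : Set (Site 2 × Fin 2 × Fin 3) | edgeConfig ((({e : Site 2 × Fin 2 | RefinementOpen 3 (S) e}) \ ({f} ∪ ↑S₁)) ∪ ({f} ∪ (({((((3 : ℤ) • b + ((0) : ℤ) • (Pi.single d (1 : ℤ) : Site 2) + ((0) : ℤ)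 • (Pi.single d' (1 : ℤ) : Site 2))), d), ((((3 : ℤ) • b + ((1) : ℤ) • (Pi.single d (1 : ℤ) : Site 2) + ((0) : ℤ) • (Pi.single d' (1 : ℤ) : Site 2))), d), ((((3 : ℤ) • b + ((2) : ℤ) • (Pi.single d (1 : ℤ) : Site 2) + ((0) : ℤ) • (Pi.single d' (1 : ℤ) : Site 2))), d)} : Set (Site 2 × Fin 2))))) ∈ KST2023.crossing (3 * n) (3 * (3 * n))}) \ ({S : Set (Site 2 × Fin 2 × Fin 3) | edgeConfig ((({e : Site 2 × Fin 2 | RefinementOpen 3 (S) e}) \ ({f} ∪ ↑S₁)) ∪ (∅ ∪ (({((((3 : ℤ) • b + ((0) : ℤ) • (Pi.single d (1 : ℤ) : Site 2) + ((0) : ℤ) • (Pi.single d' (1 : ℤ) : Site 2))), d), ((((3 : ℤ) • b + ((1) : ℤ) • (Pi.single d (1 : ℤ) : Site 2) + ((0) : ℤ) • (Pi.single d' (1 : ℤ) : Site 2))), d), ((((3 : ℤ) • b + ((2) : ℤ) • (Pi.single d (1 : ℤ) : Site 2) + ((0) : ℤ) • (Pi.single d' (1 : ℤ) : Site 2))),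 d)} : Set (Site 2 × Fin 2))))) ∈ KST2023.crossing (3 * n) (3 * (3 * n))})) ≤ (((prodBernoulli (refinementParam 3 ρ c)))).real (({S : Set (Site 2 × Fin 2 × Fin 3) | edgeConfig ((({e : Site 2 × Fin 2 | RefinementOpen 3 (S) e}) \ (({f} : Set (Site 2 × Fin 2)))) ∪ (({f} : Set (Site 2 × Fin 2)))) ∈ KST2023.crossing (3 * n) (3 * (3 * n))}) \ ({S : Set (Site 2 × Fin 2 × Fin 3) | edgeConfig ((({e : Site 2 × Fin 2 | RefinementOpen 3 (S) e}) \ (({f} : Set (Site 2 × Fin 2)))) ∪ ((∅ : Set (Site 2 × Fin 2)))) ∈ KST2023.crossing (3 * n) (3 * (3 * n))})) := by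
  intro n ρ c b d d' hd hρ0 hρ1 hc0 hc1 S₁ hS₁ f hf
  exact Cone3.chain_event_bound hd hρ0 hρ1 hc0 hc1 hS₁ hf

end Summit.CriticalPhenomena.CardyFormulaZ2.Cruxes.CriticalPathRSW.FiniteSizeEnvelope

end
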